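import Mathlib.Analysis.Calculus.BumpFunction.InnerProduct
import Literature.Analysis.FluidPDE.RieszPressureL3
import Literature.Analysis.PDE.NewtonianKernel
import Summits.NavierStokesRegularity.NavierStokesRegularity.Theorems.HardyPointSinkHardyBalanceLawIntegrability
import HarnessLib

/-!
# Route HardyPointSink — `HardyEnergyBound`, ledger stub: the plateau cut-off and slice tools

Helper file 1/5 for the glue stub `stub_hardyLedger_of` of the crux `HardyEnergyBound`
(item stmt-NavierStokesRegularity-7979, line `birth`). It provides

* the plateau cut-off `φ` at a centre `xs` and scale `R` (`= 1` on `B̄(xs, R/2)`, supported in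
  `B(xs, R)`, values in `[0, 1]`, a `ContDiffBump`), the annulus geometry of its derivatives seen
  from a sink `x₀ ∈ B(xs, R/4)` (`|x - x₀| ≥ R/4` wherever `Dφ ≠ 0`, `Δφ ≠ 0` or `φ ≠ 1`);
* integrability of the Newtonian weights `|x - x₀|⁻¹`, `|x - x₀|⁻²` on balls and the uniform bound
  `∫_{B(c,ρ)} |x - x₀|⁻¹ ≤ (5/2)|B₁| ρ²`;
* continuity of dominated parametric integrals on a time set;
* the Hölder–Stein bound `∫ |Π[w]| |w| ≤ C_{3/2} ∫ |w|³` for the Riesz pressure of an `L³` field.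
-/

noncomputable section

open MeasureTheory Set Filter Topology Metric Function
open scoped ENNReal NNReal InnerProductSpace Laplacian

set_option linter.dupNamespace false -- nested layout Summit.<S>.<Sub>, Sub = S (D-0017)

namespace Summit.NavierStokesRegularity.NavierStokesRegularity.Theorems

open Literature.Analysis.FluidPDE Literature.Analysis.PDE


/-! ### The plateau cut-off -/

/-- The plateau bump at `xs` with radii `R/2 < R`. -/
def hardyEnergyBound_ledger_bump (xs : (EuclideanSpace ℝ (Fin 3))) {R : ℝ} (hR : 0 < R) : ContDiffBump xs :=
  ⟨R / 2, R, by positivity, by linarith⟩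

/-- The plateau cut-off `φ`: smooth, `= 1` on `B̄(xs, R/2)`, supported in `B(xs, R)`, values in
`[0, 1]`. -/
def hardyEnergyBound_ledger_cutoff (xs : (EuclideanSpace ℝ (Fin 3))) {R : ℝ} (hR : 0 < R) : (EuclideanSpace ℝ (Fin 3)) → ℝ :=
  hardyEnergyBound_ledger_bump xs hR

section Cutoff

variable (xs : (EuclideanSpace ℝ (Fin 3))) {R : ℝ} (hR : 0 < R)

/-- The cut-off is smooth. -/
theorem hardyEnergyBound_ledger_cutoff_contDiff :
    ContDiff ℝ (⊤ : ℕ∞) (hardyEnergyBound_ledger_cutoff xs hR) :=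
  (hardyEnergyBound_ledger_bump xs hR).contDiff

/-- The cut-off has compact support. -/
theorem hardyEnergyBound_ledger_cutoff_hasCompactSupport :
    HasCompactSupport (hardyEnergyBound_ledger_cutoff xs hR) :=
  (hardyEnergyBound_ledger_bump xs hR).hasCompactSupport

/-- The cut-off is continuous. -/
theorem hardyEnergyBound_ledger_cutoff_continuous :
    Continuous (hardyEnergyBound_ledger_cutoff xs hR) :=
  (hardyEnergyBound_ledger_bump xs hR).continuous

/-- The cut-off is nonnegative. -/
theorem hardyEnergyBound_ledger_cutoff_nonneg (x : (EuclideanSpace ℝ (Fin 3))) :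
    0 ≤ hardyEnergyBound_ledger_cutoff xs hR x :=
  (hardyEnergyBound_ledger_bump xs hR).nonneg

/-- The cut-off is at most `1`. -/
theorem hardyEnergyBound_ledger_cutoff_le_one (x : (EuclideanSpace ℝ (Fin 3))) :
    hardyEnergyBound_ledger_cutoff xs hR x ≤ 1 :=
  (hardyEnergyBound_ledger_bump xs hR).le_one

/-- `|φ| ≤ 1`. -/
theorem hardyEnergyBound_ledger_cutoff_abs_le_one (x : (EuclideanSpace ℝ (Fin 3))) :
    |hardyEnergyBound_ledger_cutoff xs hR x| ≤ 1 := by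
  rw [abs_of_nonneg (hardyEnergyBound_ledger_cutoff_nonneg xs hR x)]
  exact hardyEnergyBound_ledger_cutoff_le_one xs hR x

/-- `|φ - 1| ≤ 1`. -/
theorem hardyEnergyBound_ledger_cutoff_abs_sub_one_le (x : (EuclideanSpace ℝ (Fin 3))) :
    |hardyEnergyBound_ledger_cutoff xs hR x - 1| ≤ 1 := by
  have h0 := hardyEnergyBound_ledger_cutoff_nonneg xs hR x
  have h1 := hardyEnergyBound_ledger_cutoff_le_one xs hR x
  rw [abs_le]; constructor <;> linarith

/-- `φ = 1` on the closed ball `B̄(xs, R/2)`. -/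
theorem hardyEnergyBound_ledger_cutoff_eq_one {x : (EuclideanSpace ℝ (Fin 3))} (hx : dist x xs ≤ R / 2) :
    hardyEnergyBound_ledger_cutoff xs hR x = 1 :=
  (hardyEnergyBound_ledger_bump xs hR).one_of_mem_closedBall (mem_closedBall.2 hx)

/-- `φ = 0` off the open ball `B(xs, R)`. -/
theorem hardyEnergyBound_ledger_cutoff_eq_zero {x : (EuclideanSpace ℝ (Fin 3))} (hx : R ≤ dist x xs) :
    hardyEnergyBound_ledger_cutoff xs hR x = 0 :=
  (hardyEnergyBound_ledger_bump xs hR).zero_of_le_dist hx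

/-- Where `φ ≠ 0`, the point lies in `B(xs, R)`. -/
theorem hardyEnergyBound_ledger_mem_ball_of_cutoff_ne_zero {x : (EuclideanSpace ℝ (Fin 3))}
    (hx : hardyEnergyBound_ledger_cutoff xs hR x ≠ 0) : x ∈ ball xs R := by
  by_contra h
  rw [mem_ball, not_lt] at h
  exact hx (hardyEnergyBound_ledger_cutoff_eq_zero xs hR h)

/-- Where `φ ≠ 1`, the point lies off `B̄(xs, R/2)`. -/
theorem hardyEnergyBound_ledger_lt_dist_of_cutoff_ne_one {x : (EuclideanSpace ℝ (Fin 3))}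
    (hx : hardyEnergyBound_ledger_cutoff xs hR x ≠ 1) : R / 2 < dist x xs := by
  by_contra h
  rw [not_lt] at h
  exact hx (hardyEnergyBound_ledger_cutoff_eq_one xs hR h)

/-- Near a point of the open ball `B(xs, R/2)` the cut-off is the constant `1`. -/
theorem hardyEnergyBound_ledger_cutoff_eventuallyEq_one {x : (EuclideanSpace ℝ (Fin 3))} (hx : dist x xs < R / 2) :
    hardyEnergyBound_ledger_cutoff xs hR =ᶠ[𝓝 x] fun _ => (1 : ℝ) :=
  (hardyEnergyBound_ledger_bump xs hR).eventuallyEq_one_of_mem_ball (mem_ball.2 hx)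

/-- `Dφ = 0` on the open ball `B(xs, R/2)`. -/
theorem hardyEnergyBound_ledger_fderiv_cutoff_eq_zero {x : (EuclideanSpace ℝ (Fin 3))} (hx : dist x xs < R / 2) :
    fderiv ℝ (hardyEnergyBound_ledger_cutoff xs hR) x = 0 := by
  rw [(hardyEnergyBound_ledger_cutoff_eventuallyEq_one xs hR hx).fderiv_eq]
  exact fderiv_const_apply 1

/-- `Δφ = 0` on the open ball `B(xs, R/2)`. -/
theorem hardyEnergyBound_ledger_laplacian_cutoff_eq_zero {x : (EuclideanSpace ℝ (Fin 3))} (hx : dist x xs < R / 2) :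
    (Δ (hardyEnergyBound_ledger_cutoff xs hR)) x = 0 := by
  rw [(InnerProductSpace.laplacian_congr_nhds
    (hardyEnergyBound_ledger_cutoff_eventuallyEq_one xs hR hx)).self_of_nhds,
    InnerProductSpace.laplacian_const]
  rfl

/-- The support of the cut-off is the closed ball `B̄(xs, R)`. -/
theorem hardyEnergyBound_ledger_tsupport_cutoff :
    tsupport (hardyEnergyBound_ledger_cutoff xs hR) = closedBall xs R :=
  (hardyEnergyBound_ledger_bump xs hR).tsupport_eq

/-- Where `Dφ ≠ 0`: the annulus `R/2 ≤ |x - xs| ≤ R`. -/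
theorem hardyEnergyBound_ledger_annulus_of_fderiv_ne_zero {x : (EuclideanSpace ℝ (Fin 3))}
    (hx : fderiv ℝ (hardyEnergyBound_ledger_cutoff xs hR) x ≠ 0) :
    R / 2 ≤ dist x xs ∧ dist x xs ≤ R := by
  constructor
  · by_contra h
    exact hx (hardyEnergyBound_ledger_fderiv_cutoff_eq_zero xs hR (not_le.1 h))
  · have h := support_fderiv_subset ℝ (mem_support.2 hx)
    rw [hardyEnergyBound_ledger_tsupport_cutoff] at h
    exact mem_closedBall.1 h

/-- Where `Δφ ≠ 0`: the annulus `R/2 ≤ |x - xs| ≤ R`. -/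
theorem hardyEnergyBound_ledger_annulus_of_laplacian_ne_zero {x : (EuclideanSpace ℝ (Fin 3))}
    (hx : (Δ (hardyEnergyBound_ledger_cutoff xs hR)) x ≠ 0) :
    R / 2 ≤ dist x xs ∧ dist x xs ≤ R := by
  constructor
  · by_contra h
    exact hx (hardyEnergyBound_ledger_laplacian_cutoff_eq_zero xs hR (not_le.1 h))
  · by_contra h
    refine hx (laplacian_eq_zero_of_notMem_tsupport ?_)
    rw [hardyEnergyBound_ledger_tsupport_cutoff]
    exact fun h' => h (mem_closedBall.1 h')

/-- `Dφ` is continuous. -/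
theorem hardyEnergyBound_ledger_continuous_fderiv_cutoff :
    Continuous (fderiv ℝ (hardyEnergyBound_ledger_cutoff xs hR)) :=
  (hardyEnergyBound_ledger_cutoff_contDiff xs hR).continuous_fderiv (by simp)

/-- `Δφ` is continuous. -/
theorem hardyEnergyBound_ledger_continuous_laplacian_cutoff :
    Continuous (Δ (hardyEnergyBound_ledger_cutoff xs hR)) :=
  continuous_laplacian ((hardyEnergyBound_ledger_bump xs hR).contDiff (n := 2))

/-- A uniform bound for `Dφ`. -/
theorem hardyEnergyBound_ledger_exists_bound_fderiv_cutoff :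
    ∃ L : ℝ, 0 ≤ L ∧ ∀ x, ‖fderiv ℝ (hardyEnergyBound_ledger_cutoff xs hR) x‖ ≤ L := by
  obtain ⟨L, hL⟩ := ((hardyEnergyBound_ledger_cutoff_hasCompactSupport xs hR).fderiv
    (𝕜 := ℝ)).exists_bound_of_continuous (hardyEnergyBound_ledger_continuous_fderiv_cutoff xs hR)
  exact ⟨max L 0, le_max_right _ _, fun x => (hL x).trans (le_max_left _ _)⟩

/-- A uniform bound for `Δφ`. -/
theorem hardyEnergyBound_ledger_exists_bound_laplacian_cutoff :
    ∃ L : ℝ, 0 ≤ L ∧ ∀ x, |(Δ (hardyEnergyBound_ledger_cutoff xs hR)) x| ≤ L := by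
  have hs : HasCompactSupport (Δ (hardyEnergyBound_ledger_cutoff xs hR)) :=
    (hardyEnergyBound_ledger_cutoff_hasCompactSupport xs hR).mono' fun x hx => by
      contrapose! hx
      exact notMem_support.2 (laplacian_eq_zero_of_notMem_tsupport hx)
  obtain ⟨L, hL⟩ := hs.exists_bound_of_continuous
    (hardyEnergyBound_ledger_continuous_laplacian_cutoff xs hR)
  refine ⟨max L 0, le_max_right _ _, fun x => ?_⟩
  rw [← Real.norm_eq_abs]
  exact (hL x).trans (le_max_left _ _)

/-! ### Geometry seen from the sink `x₀ ∈ B(xs, R/4)` -/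

/-- The sink lies in the plateau: `φ(x₀) = 1`. -/
theorem hardyEnergyBound_ledger_cutoff_sink {x₀ : (EuclideanSpace ℝ (Fin 3))} (hx₀ : x₀ ∈ ball xs (R / 4)) :
    hardyEnergyBound_ledger_cutoff xs hR x₀ = 1 :=
  hardyEnergyBound_ledger_cutoff_eq_one xs hR (by rw [mem_ball] at hx₀; linarith)

end Cutoff

/-- Off `B(xs, R/2)` (closed sense) a point is at distance `≥ R/4` from the sink. -/
theorem hardyEnergyBound_ledger_quarter_le {xs x₀ x : (EuclideanSpace ℝ (Fin 3))} {R : ℝ} (hx₀ : x₀ ∈ ball xs (R / 4))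
    (hx : R / 2 ≤ dist x xs) : R / 4 ≤ ‖x - x₀‖ := by
  rw [mem_ball] at hx₀
  have h := dist_triangle x x₀ xs
  rw [← dist_eq_norm]
  linarith

/-- `|x - x₀|⁻¹ ≤ 4/R` at distance `≥ R/4`. -/
theorem hardyEnergyBound_ledger_inv_le {R : ℝ} (hR : 0 < R) {x₀ x : (EuclideanSpace ℝ (Fin 3))} (h : R / 4 ≤ ‖x - x₀‖) :
    ‖x - x₀‖⁻¹ ≤ 4 / R := by
  have hR4 : 0 < R / 4 := by positivity
  have hr : 0 < ‖x - x₀‖ := lt_of_lt_of_le hR4 h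
  have h4 : 0 < 4 / R := by positivity
  rw [inv_le_comm₀ hr h4, inv_div]
  exact h

/-- `|x - x₀|⁻² ≤ 16/R²` at distance `≥ R/4`. -/
theorem hardyEnergyBound_ledger_inv_sq_le {R : ℝ} (hR : 0 < R) {x₀ x : (EuclideanSpace ℝ (Fin 3))} (h : R / 4 ≤ ‖x - x₀‖) :
    (‖x - x₀‖ ^ 2)⁻¹ ≤ 16 / R ^ 2 := by
  have h1 : (R / 4) ^ 2 ≤ ‖x - x₀‖ ^ 2 := pow_le_pow_left₀ (by positivity) h 2
  have hR4 : 0 < R / 4 := by positivity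
  have hr : 0 < ‖x - x₀‖ := lt_of_lt_of_le hR4 h
  rw [inv_le_comm₀ (by positivity) (by positivity)]
  have : (16 / R ^ 2)⁻¹ = (R / 4) ^ 2 := by field_simp; ring
  rw [this]
  exact h1

/-! ### The Newtonian weights -/

/-- `|x - x₀|⁻¹` is integrable on every ball. -/
theorem hardyEnergyBound_ledger_integrableOn_inv (x₀ c : (EuclideanSpace ℝ (Fin 3))) (ρ : ℝ) :
    IntegrableOn (fun x : (EuclideanSpace ℝ (Fin 3)) => ‖x - x₀‖⁻¹) (ball c ρ) := by
  have h := Newtonian.integrableOn_norm_sub_rpow_neg (E := (EuclideanSpace ℝ (Fin 3))) (by rw [finrank_euclideanSpace_fin])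
    (s := 1) (by rw [finrank_euclideanSpace_fin]; norm_num) x₀ c ρ
  refine h.congr_fun (fun x _ => ?_) measurableSet_ball
  dsimp only
  rw [Real.rpow_neg_one, norm_sub_rev]

/-- `|x - x₀|⁻²` is integrable on every ball. -/
theorem hardyEnergyBound_ledger_integrableOn_inv_sq (x₀ c : (EuclideanSpace ℝ (Fin 3))) (ρ : ℝ) :
    IntegrableOn (fun x : (EuclideanSpace ℝ (Fin 3)) => (‖x - x₀‖ ^ 2)⁻¹) (ball c ρ) := by
  have h := Newtonian.integrableOn_norm_sub_rpow_neg (E := (EuclideanSpace ℝ (Fin 3))) (by rw [finrank_euclideanSpace_fin])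
    (s := 2) (by rw [finrank_euclideanSpace_fin]; norm_num) x₀ c ρ
  refine h.congr_fun (fun x _ => ?_) measurableSet_ball
  dsimp only
  rw [Real.rpow_neg (norm_nonneg _), norm_sub_rev]
  norm_cast

/-- `|x - x₀|⁻¹` is integrable on every closed ball. -/
theorem hardyEnergyBound_ledger_integrableOn_inv_closedBall (x₀ c : (EuclideanSpace ℝ (Fin 3))) (ρ : ℝ) :
    IntegrableOn (fun x : (EuclideanSpace ℝ (Fin 3)) => ‖x - x₀‖⁻¹) (closedBall c ρ) :=
  (hardyEnergyBound_ledger_integrableOn_inv x₀ c (ρ + 1)).mono_set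
    (closedBall_subset_ball (by linarith))

/-- `|x - x₀|⁻²` is integrable on every closed ball. -/
theorem hardyEnergyBound_ledger_integrableOn_inv_sq_closedBall (x₀ c : (EuclideanSpace ℝ (Fin 3))) (ρ : ℝ) :
    IntegrableOn (fun x : (EuclideanSpace ℝ (Fin 3)) => (‖x - x₀‖ ^ 2)⁻¹) (closedBall c ρ) :=
  (hardyEnergyBound_ledger_integrableOn_inv_sq x₀ c (ρ + 1)).mono_set
    (closedBall_subset_ball (by linarith))

/-- **The uniform potential bound** `∫_{B(c,ρ)} |x - x₀|⁻¹ dx ≤ (5/2) |B₁| ρ²`, for every sink `x₀`. -/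
theorem hardyEnergyBound_ledger_setIntegral_inv_le (x₀ c : (EuclideanSpace ℝ (Fin 3))) {ρ : ℝ} (hρ : 0 < ρ) :
    ∫ x in ball c ρ, ‖x - x₀‖⁻¹ ≤
      5 / 2 * (volume : Measure (EuclideanSpace ℝ (Fin 3))).real (ball 0 1) * ρ ^ 2 := by
  have h := Newtonian.setIntegral_ball_norm_sub_rpow_neg_le (E := (EuclideanSpace ℝ (Fin 3))) (by rw [finrank_euclideanSpace_fin])
    (s := 1) zero_le_one (by rw [finrank_euclideanSpace_fin]; norm_num) c x₀ hρ
  rw [finrank_euclideanSpace_fin] at h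
  have e : ∫ x in ball c ρ, ‖x - x₀‖⁻¹ = ∫ z in ball c ρ, ‖x₀ - z‖ ^ (-(1 : ℝ)) := by
    refine setIntegral_congr_fun measurableSet_ball fun x _ => ?_
    rw [Real.rpow_neg_one, norm_sub_rev]
  rw [e]
  refine h.trans_eq ?_
  have h2 : ρ ^ ((3 : ℕ) - 1 : ℝ) = ρ ^ 2 := by norm_num
  push_cast at h2 ⊢
  rw [h2]
  norm_num

/-! ### Continuity of dominated parametric integrals on a time set -/

/-- **Dominated continuity on a set.** If `f s` is measurable and dominated by an integrable `w`
for every `s ∈ K`, and `s ↦ f s x` is continuous on `K` for a.e. `x`, then `s ↦ ∫ f s` is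
continuous on `K`. -/
theorem hardyEnergyBound_ledger_continuousOn_integral {α : Type*} [MeasurableSpace α]
    {μ : Measure α} {K : Set ℝ} {f : ℝ → α → ℝ} {w : α → ℝ}
    (hmeas : ∀ s ∈ K, AEStronglyMeasurable (f s) μ)
    (hbound : ∀ s ∈ K, ∀ᵐ x ∂μ, ‖f s x‖ ≤ w x) (hw : Integrable w μ)
    (hcont : ∀ᵐ x ∂μ, ContinuousOn (fun s => f s x) K) :
    ContinuousOn (fun s => ∫ x, f s x ∂μ) K := by
  intro s₀ hs₀
  refine continuousWithinAt_of_dominated ?_ ?_ hw ?_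
  · filter_upwards [self_mem_nhdsWithin] with s hs using hmeas s hs
  · filter_upwards [self_mem_nhdsWithin] with s hs using hbound s hs
  · filter_upwards [hcont] with x hx using hx s₀ hs₀

/-! ### Hölder–Stein: `∫ |Π[w]| |w| ≤ C_{3/2} ∫ |w|³` -/

/-- `‖w‖_{L³}³ = ∫⁻ |w|³` (natural power). -/
theorem hardyEnergyBound_ledger_eLpNorm_three_pow (w : (EuclideanSpace ℝ (Fin 3)) → (EuclideanSpace ℝ (Fin 3))) :
    eLpNorm w 3 volume ^ 3 = ∫⁻ x, ‖w x‖ₑ ^ 3 := by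
  rw [eLpNorm_eq_lintegral_rpow_enorm_toReal (by norm_num) (by norm_num)]
  have h3 : (3 : ℝ≥0∞).toReal = 3 := by norm_num
  rw [h3, ← ENNReal.rpow_natCast, ← ENNReal.rpow_mul]
  norm_num

/-- **Hölder–Stein.** For `w ∈ L³`, `|Π[w]| |w|` is integrable and
`∫ |Π[w]| |w| ≤ C_{3/2} ∫ |w|³`. -/
theorem hardyEnergyBound_ledger_integral_abs_rieszPressure_mul_norm_le {w : (EuclideanSpace ℝ (Fin 3)) → (EuclideanSpace ℝ (Fin 3))}
    (hw : MemLp w 3 volume) :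
    Integrable (fun x => |rieszPressure w x| * ‖w x‖) volume ∧
      ∫ x, |rieszPressure w x| * ‖w x‖ ≤ steinConstThreeHalves * ∫ x, ‖w x‖ ^ 3 := by
  have hPm : AEStronglyMeasurable (rieszPressure w) volume := aestronglyMeasurable_rieszPressure hw
  have hpq : (3 / 2 : ℝ).HolderConjugate 3 := by
    rw [Real.holderConjugate_iff]; norm_num
  -- Hölder in `ℝ≥0∞`
  have hH : ∫⁻ x, ‖rieszPressure w x‖ₑ * ‖w x‖ₑ ≤
      eLpNorm (rieszPressure w) (3 / 2 : ℝ≥0∞) volume * eLpNorm w 3 volume := by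
    have h := ENNReal.lintegral_mul_le_Lp_mul_Lq volume hpq hPm.enorm hw.1.enorm
    have e1 : eLpNorm (rieszPressure w) (3 / 2 : ℝ≥0∞) volume =
        (∫⁻ x, ‖rieszPressure w x‖ₑ ^ (3 / 2 : ℝ)) ^ (1 / (3 / 2 : ℝ)) := by
      rw [eLpNorm_eq_lintegral_rpow_enorm_toReal (by norm_num)
        (ENNReal.div_ne_top (by norm_num) (by norm_num))]
      have : (3 / 2 : ℝ≥0∞).toReal = 3 / 2 := by
        rw [ENNReal.toReal_div]; norm_num
      rw [this]
    have e2 : eLpNorm w 3 volume = (∫⁻ x, ‖w x‖ₑ ^ (3 : ℝ)) ^ (1 / (3 : ℝ)) := by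
      rw [eLpNorm_eq_lintegral_rpow_enorm_toReal (by norm_num) (by norm_num)]
      have : (3 : ℝ≥0∞).toReal = 3 := by norm_num
      rw [this]
    rw [e1, e2]
    exact h
  have hS : eLpNorm (rieszPressure w) (3 / 2 : ℝ≥0∞) volume * eLpNorm w 3 volume ≤
      steinConstThreeHalves * ∫⁻ x, ‖w x‖ₑ ^ 3 := by
    calc eLpNorm (rieszPressure w) (3 / 2 : ℝ≥0∞) volume * eLpNorm w 3 volume
        ≤ (steinConstThreeHalves * eLpNorm w 3 volume ^ 2) * eLpNorm w 3 volume :=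
          mul_le_mul' (eLpNorm_rieszPressure_le hw) le_rfl
      _ = steinConstThreeHalves * eLpNorm w 3 volume ^ 3 := by ring
      _ = steinConstThreeHalves * ∫⁻ x, ‖w x‖ₑ ^ 3 := by
          rw [hardyEnergyBound_ledger_eLpNorm_three_pow]
  have hw3 : Integrable (fun x => ‖w x‖ ^ 3) volume := hw.integrable_norm_pow three_ne_zero
  have hlin3 : ∫⁻ x, ‖w x‖ₑ ^ 3 = ENNReal.ofReal (∫ x, ‖w x‖ ^ 3) := by
    rw [ofReal_integral_eq_lintegral_ofReal hw3 (Eventually.of_forall fun x => by positivity)]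
    refine lintegral_congr fun x => ?_
    rw [← ofReal_norm, ENNReal.ofReal_pow (norm_nonneg _)]
  have hfin : ∫⁻ x, ‖rieszPressure w x‖ₑ * ‖w x‖ₑ < ⊤ := by
    refine (hH.trans hS).trans_lt ?_
    rw [hlin3]
    exact ENNReal.mul_lt_top ENNReal.coe_lt_top ENNReal.ofReal_lt_top
  have hm : AEStronglyMeasurable (fun x => |rieszPressure w x| * ‖w x‖) volume :=
    (continuous_abs.comp_aestronglyMeasurable hPm).mul hw.1.norm
  have henorm : ∀ x, ‖|rieszPressure w x| * ‖w x‖‖ₑ = ‖rieszPressure w x‖ₑ * ‖w x‖ₑ := fun x => by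
    rw [enorm_mul, Real.enorm_abs, enorm_norm]
  have hint : Integrable (fun x => |rieszPressure w x| * ‖w x‖) volume := by
    refine ⟨hm, ?_⟩
    rw [HasFiniteIntegral]
    simp_rw [henorm]
    exact hfin
  refine ⟨hint, ?_⟩
  have hnn : 0 ≤ᵐ[volume] fun x => |rieszPressure w x| * ‖w x‖ :=
    Eventually.of_forall fun x => by positivity
  rw [integral_eq_lintegral_of_nonneg_ae hnn hm]
  have e3 : ∫⁻ x, ENNReal.ofReal (|rieszPressure w x| * ‖w x‖) = ∫⁻ x, ‖rieszPressure w x‖ₑ * ‖w x‖ₑ :=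
    lintegral_congr fun x => by rw [← henorm, Real.enorm_eq_ofReal (by positivity)]
  rw [e3]
  have hne : (steinConstThreeHalves : ℝ≥0∞) * ∫⁻ x, ‖w x‖ₑ ^ 3 ≠ ⊤ := by
    rw [hlin3]; exact ENNReal.mul_ne_top ENNReal.coe_ne_top ENNReal.ofReal_ne_top
  have h := ENNReal.toReal_mono hne (hH.trans hS)
  rw [ENNReal.toReal_mul, hlin3, ENNReal.toReal_ofReal (integral_nonneg fun x => by positivity)] at h
  simpa using h

/-- **Anchor of this helper file** (registered sub-goal of `stub_hardyLedger_of`): the Hölder–Stein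
bound `∫ |Π[w]| |w| ≤ C_{3/2} ∫ |w|³` for `w ∈ L³`. -/
theorem hardyEnergyBound_ledger_holderStein :
    ∀ (w : EuclideanSpace ℝ (Fin 3) → EuclideanSpace ℝ (Fin 3)),
      MeasureTheory.MemLp w 3 MeasureTheory.volume →
      MeasureTheory.Integrable (fun x => |Literature.Analysis.FluidPDE.rieszPressure w x| * ‖w x‖)
        MeasureTheory.volume ∧
      ∫ x, |Literature.Analysis.FluidPDE.rieszPressure w x| * ‖w x‖ ≤
        (Literature.Analysis.FluidPDE.steinConstThreeHalves : ℝ) * ∫ x, ‖w x‖ ^ 3 :=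
  fun _ hw => hardyEnergyBound_ledger_integral_abs_rieszPressure_mul_norm_le hw

end Summit.NavierStokesRegularity.NavierStokesRegularity.Theorems

end
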